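/-
Copyright (c) 2026 the pub-hodgecm-mathlib formalisation cell (harness21).  R90-TF SLAB, section S10 (Rogawski 1990, Ch. 13.5–13.8 comparison engine read at `v`),
prover R90-C138-p02 (g0) — card 6a₀ (dealer R90-C138-plan (g2) DEAL #7 + RULING J-6b-1): ★ `S10MemberFlath` FROM `S10MemG` + the 6b data at the canonical finite model;
h413 = `stmt-HodgeConjecture-24833`, route `HCCMUnconditional`.
-/
import Summits.HodgeConjecture.HodgeConjecture.Theorems.R90S10MemberFinModelDefs    -- ★ (this seat, 6a₀ defs): `memberSlot`, `memberBase`, `memberFinModel` + read-backs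
import Summits.HodgeConjecture.HodgeConjecture.Theorems.R90S10GCutMemberFlathDefs    -- ★ p863179 (this seat): `S10MemberFlath`
import HarnessLib

/-!
# R90-TF ∕ S10 — card 6a₀: THE MEMBER PACKAGE ★ `S10MemberFlath` FROM MEMBERSHIP + THE ARCHIMEDEAN DATA AT THE CANONICAL MODEL
# (`Theorems/R90S10MemberFlathOfArchSplit.lean`; ns `Summit.HodgeConjecture.HodgeConjecture.R90.S10`; DEAL #7 + RULING J-6b-1 of R90-C138-plan (g2), 2026-09-05)

Cell `hodgecm-mathlib`, crux H413 (`stmt-HodgeConjecture-24833`), route of record `HCCMUnconditional`; programme R90-TF, section S10 (base `R90-C138`).  PROOF lane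
(`--kind proof --supports stmt-HodgeConjecture-24833 --as helper`): one theorem; no `def`, no instance, no notation, no named fact, no `sorry`; imports ★ only (law L9).

THE CHAIN OF RECORD (A2d `sock_S10_levelCutG`): A2d ⟸ ★ `levelCutG_of_row3_flath` (p863479) ⟸ {`Row3G3Letter` (★-paid mod E1 12R3), `MemberFlathLetter 𝔥 𝔳` = «∃ normalised
`(μG, νG)`, every CONTRIBUTING `S10MemG`-class carries ★ `S10MemberFlath`»}.  THIS FILE: `S10MemberFlath … c πc` ⟸ `S10MemG … c πc` + the 6b DATA at the canonical model
★ `memberFinModel 𝔳 πc _` (scalar `a`, irreducible unitary `ϖ` of `G_∞`, `hop : HasArchOpTrace 𝔥.νGi ϖ hu hsc 𝔳.fGi a`, `hsplit` at `σ := memberFinModel …`) — binders =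
★ `S10MemberFlath`'s own `a E ϖ hu hsc hirri hop hsplit` fields TOKEN FOR TOKEN at the model (= the BODY of R90-C138-p03's ★-letter `ArchFinSplitG3Letter … c (memberFinModel …)`
behind its guard; RULING J-6b-1 (3)), so the glue `memberFlath_of_archSplitLetter` is a one-liner once that def is in the tree (sequel, additions-only).  What remains NAMED
after this file: 6b (the archimedean split for a GIVEN finite component, E1b∕S2, XL) and its guard at the model = 6a₁ (Flath: `σf ≅ memberFinModel`, S10, L).
[Rogawski1990, §13.8 p. 218 L22–L28, p. 219 L1–L3; FlathCorvallis1979 Thm. 3; BorelJacquet1979 §4.3∕§4.6; Knapp1986 Thm. 10.2]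
HONEST LABEL: closes no socket (`sock_S10_memberFlath` is A ED. 4's); HC_CM is proved only modulo the 7 printed citations (2 remaining named inputs: hLiu418 =
`stmt-HodgeConjecture-24832`, h413 = `stmt-HodgeConjecture-24833`) until rung 0 closes; REL ≠ ★ ≠ BUILT; count-neutral.

## References
* [Rogawski1990] J. D. Rogawski, *Automorphic Representations of Unitary Groups in Three Variables*, Ann. of Math. Stud. 123 (1990), §13.8 pp. 218–219.
* [FlathCorvallis1979] D. Flath, *Decomposition of representations into tensor products*, PSPM 33.1 (1979), Thm. 3.
* [BorelJacquet1979] A. Borel, H. Jacquet, *Automorphic forms and automorphic representations*, PSPM 33.1 (1979), §4.3, §4.6.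
* [Knapp1986] A. Knapp, *Representation Theory of Semisimple Groups* (1986), Thm. 10.2.
-/

set_option autoImplicit false
set_option linter.dupNamespace false

noncomputable section

open scoped RestrictedProduct Matrix MatrixGroups
open Filter MeasureTheory NumberField IsDedekindDomain CompactlySupported
open Literature.NumberTheory.Rogawski1990 Literature.NumberTheory.Automorphic Literature.NumberTheory.Automorphic.UnitaryGroup
open Literature.NumberTheory.Automorphic.UnitaryGroup.CotangentForms Literature.NumberTheory.GaloisRepresentations
open Literature.NumberTheory.Automorphic.Arthur2013.Leaves.TECR
open Summit.HodgeConjecture.HodgeConjecture.Cruxes.H413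
open Summit.HodgeConjecture.HodgeConjecture.Cruxes.H413.K2E1TraceFormulaBeta
open Summit.HodgeConjecture.HodgeConjecture.Cruxes.H413.K2E1SpectralTermsDiscreteHalf
open Summit.HodgeConjecture.HodgeConjecture.Cruxes.H413.K2E1bGKCohomologyU21.U8 (HasArchOpTrace)

namespace Summit.HodgeConjecture.HodgeConjecture.R90.S10

section Ctor

variable {L : Type} [Field L] [NumberField L] [IsCMField L] [DecidableEq (Pl L)] {μ : HeckeCharacter L} {v : Pl L}
  [MeasurableSpace (HLoc L v)] [BorelSpace (HLoc L v)] [MeasurableSpace (Gqs L v)] [BorelSpace (Gqs L v)]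
  {νHv : Measure (HLoc L v)} {νQv : Measure (Gqs L v)} [νHv.IsHaarMeasure] [νHv.IsMulRightInvariant] [νQv.IsHaarMeasure] [νQv.IsMulRightInvariant]
  [∀ a : HLoc L v, MeasurableSpace (HLoc L v ⧸ Subgroup.centralizer ({a} : Set (HLoc L v)))]
  [∀ a : HLoc L v, BorelSpace (HLoc L v ⧸ Subgroup.centralizer ({a} : Set (HLoc L v)))]
  [∀ γ : Gqs L v, MeasurableSpace (Gqs L v ⧸ Subgroup.centralizer ({γ} : Set (Gqs L v)))]
  [∀ γ : Gqs L v, BorelSpace (Gqs L v ⧸ Subgroup.centralizer ({γ} : Set (Gqs L v)))]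
  {mHv : OrbitalMeasureFamily (HLoc L v)} {mQv : OrbitalMeasureFamily (Gqs L v)} {πSt : IrrClass (HLoc L v)}
  [MeasurableSpace (H2 L).Adelic] [BorelSpace (H2 L).Adelic]
  [MeasurableSpace (GArch L)] [BorelSpace (GArch L)] [MeasurableSpace (HArch L)] [BorelSpace (HArch L)]
  [MeasurableSpace (H1Loc L v)] [MeasurableSpace (H1Arch L)] [MeasurableSpace (H1 L).Adelic] [BorelSpace (H1 L).Adelic]

/-- **THE PER-MEMBER FLATH ⊗ ARCHIMEDEAN PACKAGE FROM MEMBERSHIP + THE 6b DATA AT THE CANONICAL MODEL** (card 6a₀; RULING J-6b-1).  For a discrete class `c` of `U(Φ₃)`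
with local classes `πc` satisfying THE membership predicate ★ `S10MemG` (`IsLinked` ∧ `LiesOver` off `v`): GIVEN the archimedean half of card 6b AT THE CANONICAL MODEL — a
scalar `a`, an irreducible unitary Hilbert representation `ϖ` of `G_∞` with `HasArchOpTrace 𝔥.νGi ϖ 𝔳.fGi a` («`a = Θ_{π_∞}(f_∞)`») and the arch–fin split of the class trace
`Tr c(f_∞ ⊗ φ ⊗ 𝟙_{K^v}) = a · Tr (memberFinModel …)(φ ⊗ 𝟙_{K^v})` on matched pairs (= the BODY of ★ `ArchFinSplitG3Letter … c (memberFinModel …)`, R90-C138-p03, token for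
token) — the package ★ `S10MemberFlath … 𝔥 𝔳 μG νG c πc` is inhabited: slots ★ `memberSlot` (`hcls` = ★ `mk_memberSlot`), base ★ `memberBase`, `σ := memberFinModel`,
`j := RestrictedTensorProduct.tprod ℂ`, `S₀ := {v}` (★ `isRestrictedTensorProductRep_memberFinModel`), `hline` (★ `memberBase_spec`), `hadm` (★ `isAdmissible_memberSlot` on
`IsLinked`'s `HasLocalClasses`).  The residual named inputs of `MemberFlathLetter` are thereby EXACTLY 6b (the archimedean split, E1b∕S2) + its guard 6a₁ (the Flath iso
`σf ≅ memberFinModel`, S10). [cite: Rogawski1990, §13.8 p. 218 L22–L28, p. 219 L1–L3] [cite: FlathCorvallis1979, Thm. 3] [cite: BorelJacquet1979, §4.3 and §4.6]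
[cite: Knapp1986, Thm. 10.2] -/
theorem memberFlath_of_archData [MeasurableSpace (G3 L).Adelic] [BorelSpace (G3 L).Adelic]
    (𝔥 : S10HDatum L μ v νHv νQv mHv mQv πSt) (𝔳 : S10Frozen L μ v νHv νQv mHv mQv πSt 𝔥)
    (μG : Measure (G3 L).automorphicQuotient) [(G3 L).IsAutomorphicMeasure μG] (νG : Measure (G3 L).Adelic) [νG.IsHaarMeasure]
    (c : DiscreteClass (G3 L) μG) (πc : ∀ w : Pl L, IrrClass (Gqs L w)) (hmem : S10MemG L μ v νHv νQv mHv mQv πSt 𝔥 𝔳 μG c πc)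
    (a : ℂ) (E : Type) [NormedAddCommGroup E] [InnerProductSpace ℂ E] [CompleteSpace E] (ϖ : ContRepresentation ℂ (GArch L) E)
    (hu : ϖ.IsUnitary) (hsc : ϖ.IsStronglyContinuous) (hirri : ϖ.IsTopIrreducible)
    (hop : haveI := 𝔥.hνGi; HasArchOpTrace 𝔥.νGi ϖ hu hsc 𝔳.fGi a)
    (hsplit : ∀ fH φ, MatchE1 L μ v mHv mQv fH φ →
      c.classTrace νG (𝔳.ΦG φ) =
        a * (haveI := 𝔳.hKo; @Representation.smoothTrace _ _ _ _ 𝔳.msF _ _ _ (memberFinModel 𝔳 πc fun w hw => (hmem.2 ⟨w, hw⟩).1) 𝔳.νf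
          (fun g : Πʳ w : Pl L, [Gqs L w, 𝔳.K w] => φ (g v) *
            Set.indicator {g : Πʳ w : Pl L, [Gqs L w, 𝔳.K w] | ∀ w, w ≠ v → g w ∈ 𝔳.K w} (fun _ => (1 : ℂ)) g))) :
    Nonempty (S10MemberFlath L μ v νHv νQv mHv mQv πSt 𝔥 𝔳 μG νG c πc) := by
  have hsph : ∀ w : Pl L, w ≠ v → (πc w).IsSpherical (𝔳.K w) := fun w hw => (hmem.2 ⟨w, hw⟩).1
  obtain ⟨P, Wf, _, _, σf, hPc, hPσf, hσf⟩ := hmem.1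
  exact ⟨{
    V := fun w => (memberSlot πc w).V
    acV := fun w => (memberSlot πc w).instAddCommGroup
    mdV := fun w => (memberSlot πc w).instModule
    ρ := fun w => (memberSlot πc w).ρ
    hirr := fun w => (memberSlot πc w).isIrreducible
    hsm := fun w => (memberSlot πc w).isSmooth
    hcls := fun w => mk_memberSlot πc w
    x₀ := memberBase 𝔳 πc hsph
    W := RestrictedTensorProduct ℂ (memberBase 𝔳 πc hsph)
    σ := memberFinModel 𝔳 πc hsph
    hx₀ := memberBase_eventually 𝔳 πc hsph
    j := RestrictedTensorProduct.tprod ℂ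
    S₀ := {v}
    hσ := isRestrictedTensorProductRep_memberFinModel 𝔳 πc hsph
    hS₀ := subset_rfl
    hline := fun w hw => (memberBase_spec 𝔳 πc hsph w hw).2.2
    hadm := fun w => isAdmissible_memberSlot πc hσf w
    a := a, E := E, ϖ := ϖ, hu := hu, hsc := hsc, hirri := hirri, hop := hop
    hsplit := hsplit }⟩

end Ctor

end Summit.HodgeConjecture.HodgeConjecture.R90.S10

end
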